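import Summits.QuantumFields.YangMills.Theorems.UnitScaleTiltProp8ChartKernelFlatTower
import Summits.QuantumFields.YangMills.Theorems.UnitScaleTiltProp8ChartDoubleBarDiffBall
import HarnessLib

/-!
# Route `UnitScaleTilt`, crux K1 «MinimiserStabilityRegPr» (stmt-QuantumFields-19200), stub V2′ `stub_halvingStep`, C_E node after RULING g26-№6 — (S4′) THE ONE-STEP
# HOLOMORPHY OF THE DOUBLE-BAR CHART ON THE READ BALL (discharged from (S3) B2 ✓`differentiableAt_coe_dbarAvgU_of_twoBlock`) AND THE UNCONDITIONAL (148) LETTER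

Cell `ym3-torus` (HUMAN RULING D-0037: YM₃ on the torus is ladder rung R3, not the Clay problem), width seat `ym-ust-19936-w5` gen 3; `--supports stmt-QuantumFields-19200
--as helper`; def-free, 0 sorry.  ★★OWNER ACK 20 (a): «(S4′) GO».

WHY.  ✓`ChartKernelFlat.norm_fderiv_phiRem_le` (F3a) is print's (148) for the one-step double-bar chart in log coordinates with ONE displayed hypothesis — ℂ-differentiability of
`W ↦ Φ_m(W)(c) = −i·log U̿(e^{iW})(c)` at every `W` of read size `< R`.  LEAD ★w5-19200 g3's B2 (✓p612034 `…ChartDoubleBarDiffBall`) exports exactly the needed one-step engine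
`differentiableAt_coe_dbarAvgU_of_twoBlock` (+ `norm_stairHol_sub_one_lt_one`; loops by ✓`norm_loopHolU_sub_one_lt_one`), so the hypothesis is discharged here and the letter
becomes unconditional: `hE` of ✓`ChartKernelTower.kernel_tower_bound` for the ♭ tower, `G = 2560ℓ/R`, k-free.
WHAT.  `differentiableAt_coe_expL` (`W ↦ e^{iW_b}` is entire), ★ `differentiableAt_phi_of_readBall` (`400ℓR ≤ 1`, read size `< R` ⇒ `Φ_m(·)(c)` differentiable: bond variables entire,
loop and stair transporters within `1` of `1` at size `2R`, `U̿` within `40ℓR ≤ 1/10` of `1` so `log` is analytic there), ★★ `norm_fderiv_phiRem_le'` — (148) for the ♭ one step with NO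
displayed hypothesis: `‖D(Φ_m(·)(c) − L·Q(·)(c))(V)[w]‖ ≤ (2560ℓ/R)·s·Σ_{b∈Rd(c)}‖w b‖` for `‖V‖ ≤ s < R/8` on the read set.
HONEST SCOPE.  One-step calculus; the tower assembly is the next file.  NOT a claim about the stub, the crux, the rung or the mass gap.

References: T. Bałaban, CMP **98** (1985) 17–51 [Balaban1985Averaging] ((122)–(125) p.36, (148) p.40); CMP **102** (1985) 277–309 [Balaban1985Variational] ((152) p.301).
-/

noncomputable section

open scoped BigOperators Matrix.Norms.L2Operator
open NormedSpace Metric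

namespace Summit.QuantumFields.YangMills.Theorems.ChartKernelFlat

open Literature.MathematicalPhysics.QuantumFieldTheory.Balaban1983to89
open T4Continuum BlockAveraging MatrixLog
open LatticeFieldCalculus (bondAvg)
open Summit.QuantumFields.YangMills.Theorems.Prop8Chart (isUnit_exp_I_eta loopHolU)
open Summit.QuantumFields.YangMills.Theorems.Prop8ChartDoubleBar

variable {P : Params} {m : ℕ}

/-! ## §1 Holomorphy of the one step on the read ball -/

section Holo

variable {𝔸 : Type*} [NormedRing 𝔸] [NormedAlgebra ℂ 𝔸] [CompleteSpace 𝔸]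

/-- `W ↦ e^{iW_b}` is ℂ-differentiable everywhere (the exponential is entire). [cite: Balaban1985Variational, (152) p.301] -/
theorem differentiableAt_coe_expL (b : PBond P m) (W₀ : PBond P m → 𝔸) :
    DifferentiableAt ℂ (fun W : PBond P m → 𝔸 => (((isUnit_exp_I_eta 1 (W b)).unit : 𝔸ˣ) : 𝔸)) W₀ := by
  have h : (fun W : PBond P m → 𝔸 => (((isUnit_exp_I_eta 1 (W b)).unit : 𝔸ˣ) : 𝔸)) = fun W => exp (Complex.I • W b) := by
    funext W; exact coe_expL W b
  rw [h]
  have hproj : DifferentiableAt ℂ (fun W : PBond P m → 𝔸 => W b) W₀ :=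
    (ContinuousLinearMap.proj (R := ℂ) (φ := fun _ : PBond P m => 𝔸) b).differentiableAt
  exact (exp_analytic _).differentiableAt.comp W₀ (hproj.const_smul Complex.I)

/-- ★ **ONE-STEP HOLOMORPHY ON THE READ BALL**: for `400ℓR ≤ 1` and `W` with `‖W_b‖ < R` on the two-block read set of `c`, `W′ ↦ Φ_m(W′)(c) = −i·log U̿(e^{iW′})(c)` is ℂ-differentiable at `W`
(✓B2 `differentiableAt_coe_dbarAvgU_of_twoBlock`: the bond variables are entire, the loop and stair transporters at `W` are within `1` of `1` since the two-block variables are within `2R` of `1`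
and `8ℓR < 1`; then `U̿` is within `40ℓR ≤ 1/10` of `1`, where `log` is analytic). [cite: Balaban1985Averaging, Prop. 3 p.36, (110) p.34; Balaban1985Variational, (152) p.301] -/
theorem differentiableAt_phi_of_readBall [NormOneClass 𝔸] (hm : m + 1 ≤ P.m + P.K) (c : PBond P (m + 1)) {R : ℝ} (hR : 0 < R)
    (hR400 : 400 * (((P.d + 2) * P.L : ℕ) : ℝ) * R ≤ 1) {W : PBond P m → 𝔸}
    (hW : ∀ b : PBond P m, (blockOf b.src = c.src ∨ blockOf b.src = c.tgt) → (blockOf b.tgt = c.src ∨ blockOf b.tgt = c.tgt) → ‖W b‖ < R) :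
    DifferentiableAt ℂ (fun W' : PBond P m → 𝔸 =>
      (-Complex.I) • mlog (((dbarAvgU (fun b : PBond P m => (isUnit_exp_I_eta 1 (W' b)).unit) c : 𝔸ˣ) : 𝔸))) W := by
  set ℓ : ℝ := (((P.d + 2) * P.L : ℕ) : ℝ) with hℓ
  have hℓ1 : (1 : ℝ) ≤ ℓ := by
    rw [hℓ]; exact_mod_cast Nat.one_le_iff_ne_zero.mpr (Nat.mul_ne_zero (by omega) P.L_pos.ne')
  have hR1 : R ≤ 1 := by nlinarith
  -- two-block group sizes at the base point
  have hS : ∀ b : PBond P m, (blockOf b.src = c.src ∨ blockOf b.src = c.tgt) → (blockOf b.tgt = c.src ∨ blockOf b.tgt = c.tgt) →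
      ‖((((fun b : PBond P m => (isUnit_exp_I_eta 1 (W b)).unit) b : 𝔸ˣ)) : 𝔸) - 1‖ ≤ 2 * R := fun b hs ht =>
    (norm_coe_expL_sub_one_le W b ((hW b hs ht).le.trans hR1)).trans (by linarith [(hW b hs ht).le])
  have h4 : 4 * ℓ * (2 * R) < 1 := by nlinarith
  have h2R : 0 ≤ 2 * R := by linarith
  -- the group-level one step is differentiable at `W`
  have hgrp : DifferentiableAt ℂ (fun W' : PBond P m → 𝔸 =>
      ((dbarAvgU (fun b : PBond P m => (isUnit_exp_I_eta 1 (W' b)).unit) c : 𝔸ˣ) : 𝔸)) W :=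
    differentiableAt_coe_dbarAvgU_of_twoBlock hm (F := fun W' : PBond P m → 𝔸 => fun b : PBond P m => (isUnit_exp_I_eta 1 (W' b)).unit) c
      (fun b _ _ => differentiableAt_coe_expL b W)
      (fun i => Prop8Chart.norm_loopHolU_sub_one_lt_one hm c h2R h4 hS i)
      (fun y hy i => by
        refine norm_stairHol_sub_one_lt_one hm y h2R h4 (fun b h1 h2 => hS b ?_ ?_) i
        · rcases hy with rfl | rfl
          · exact Or.inl h1
          · exact Or.inr h1
        · rcases hy with rfl | rfl
          · exact Or.inl h2
          · exact Or.inr h2)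
  -- the value is in the log-ball
  have hval : ‖((dbarAvgU (fun b : PBond P m => (isUnit_exp_I_eta 1 (W b)).unit) c : 𝔸ˣ) : 𝔸) - 1‖ < 1 := by
    have h := (norm_phi_le hm c hR.le hR400 fun b hs ht => (hW b hs ht).le).1
    have : 40 * ℓ * R < 1 := by nlinarith
    exact h.trans_lt this
  exact ((analyticAt_mlog hval).differentiableAt.comp W hgrp).const_smul (-Complex.I)

end Holo

/-! ## §2 The (148) letter of the double-bar one step, unconditionally -/

section Kernel

variable {n : Type*} [Fintype n] [DecidableEq n] [Nonempty n]

/-- ★★ **(148) FOR THE DOUBLE-BAR ONE STEP, NO DISPLAYED HYPOTHESIS** (✓`norm_fderiv_phiRem_le` with its holomorphy input discharged by `differentiableAt_phi_of_readBall`): for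
`400ℓR ≤ 1`, `‖V_b‖ ≤ s` on the two-block read set of `c`, `0 ≤ s < R/8`, and every direction `w`,
`‖D(Φ_m(·)(c) − L·Q(·)(c))(V)[w]‖ ≤ (2560ℓ/R)·s·Σ_{b∈Rd(c)}‖w b‖` — the `hE` letter of ✓`ChartKernelTower.kernel_tower_bound` for the ♭ tower, `G = 2560ℓ/R` (matrix algebras `M_n(ℂ)`).
[cite: Balaban1985Averaging, (148) p.40, (140) p.39] -/
theorem norm_fderiv_phiRem_le' [DecidableEq (PBond P m)] (hm : m + 1 ≤ P.m + P.K) (c : PBond P (m + 1)) {R : ℝ} (hR : 0 < R)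
    (hR400 : 400 * (((P.d + 2) * P.L : ℕ) : ℝ) * R ≤ 1)
    {V : PBond P m → Matrix n n ℂ} {s : ℝ} (hs0 : 0 ≤ s) (hs : s < R / 8)
    (hV : ∀ b : PBond P m, (blockOf b.src = c.src ∨ blockOf b.src = c.tgt) → (blockOf b.tgt = c.src ∨ blockOf b.tgt = c.tgt) → ‖V b‖ ≤ s)
    (w : PBond P m → Matrix n n ℂ) :
    ‖fderiv ℂ (fun W : PBond P m → Matrix n n ℂ =>
        (-Complex.I) • mlog (((dbarAvgU (fun b : PBond P m => (isUnit_exp_I_eta 1 (W b)).unit) c : (Matrix n n ℂ)ˣ) : Matrix n n ℂ)) -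
          ((P.L : ℕ) : ℂ) • bondAvg W c) V w‖ ≤
      2560 * (((P.d + 2) * P.L : ℕ) : ℝ) / R * s *
        ∑ b ∈ Finset.univ.filter (fun b : PBond P m => (blockOf b.src = c.src ∨ blockOf b.src = c.tgt) ∧ (blockOf b.tgt = c.src ∨ blockOf b.tgt = c.tgt)), ‖w b‖ :=
  norm_fderiv_phiRem_le hm c hR hR400 (fun _ hW => differentiableAt_phi_of_readBall hm c hR hR400 hW) hs0 hs hV w

end Kernel

end Summit.QuantumFields.YangMills.Theorems.ChartKernelFlat

end
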